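import Mathlib

/-!
# `Balaban1983to89.B12Eq117Membership` — T. Bałaban, *Renormalization group approach to lattice gauge field
theories. I*, Commun. Math. Phys. **109** (1987) 249–301 [Balaban1987RG1]: (1.17) p. 263 and the membership remark
around it, as a kernel-checked SCHEMA (the Proposition 9 [15] output enters as a hypothesis shape; the printed
arithmetic and the «for α₀′ sufficiently small» step are PROVED with an explicit threshold)

HONEST FRAMING (cell `lit-balaban`, verbatim): statement-level skeleton of published theorems with citation tags; proofs where landed; nothing here is a claim about the Yang–Mills mass gap.

PDF held: `paper:balaban1987-cmp109-rg-i-small-field` (journal page = PDF page + 248); read from the page render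
`b2b-balaban-ref1/pages/1987-cmp109-rg-I-small-field/…-p015-x2.png` (p. 263) and `…-p014-x2.png` (p. 262, conditions
(i)–(iv)).  SKELETON row `B12.Eq1.17` (absent before this file; 39 dependants in DEPGRAPH v3; the B15 twin of the
same display is `B15Membership195.Shape117`).

THE PRINT, verbatim (p. 263).  *«At first we show that there are some simple and natural spaces contained in
U^c_j(X, α₀, α₁). Let us take the space of configurations (𝐔, 𝐉) satisfying the conditions (i)–(iii) with constants
α₀′, α₁′ instead of α₀, α₁. We assume that the constants α₀′, α₁′ are smaller than α₀, α₁ correspondingly, then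
obviously these three conditions are satisfied in the original formulation. Now consider the functions U_n(M˙(𝐔)). We
have M˙(𝐔) = Ū^p on Λ_p, |∂Ū^p − 1| < 2α₀′(L^pξ)². From Proposition 9 [15] we obtain
  |∂U_n(M˙(𝐔)) − 1| < B₃2α₀′L^{−2n}(L^nξ)² = 2B₃α₀′ξ²,  |J_n(M˙(𝐔))| < B₃2α₀′(L^nξ)²  on X̃^{−2}. (1.17)
It is obvious that for α₀′ sufficiently small the above estimates imply the condition (iv), thus the configuration
(𝐔, 𝐉) belongs to the space U^c_j(X, α₀, α₁).»*  Condition (iv) (p. 262, (1.15)–(1.16)): the functions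
`U_n(M˙(𝐔))`, `J_n(M˙(𝐔))`, `n ≤ j`, satisfy `|∂U_n(M˙(𝐔)) − 1| < α₀ξ²`, `|J_n(M˙(𝐔))| < α₀(L^nξ)²` on `X̃^{−2}`
(spaces with `γ₀ = α₀`, p. 263: *«Usually we consider spaces with γ₀ = α₀»*).

THE TYPING.  The tree's carrier of `U^c_j(X, α₀, α₁, γ₀)` is ABSTRACT (`Setup.CplxRegularSpace`: a family of sets
monotone in the radii; conditions (i)–(iv) reader-owned, DIVERGENCE F8), and Proposition 9 [15] is the abstract
`B11.Prop9Printed`.  Accordingly this file is a SCHEMA at fixed `X`, `j`: `Model` = the set `condI_III α₀ α₁` of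
configurations satisfying (i)–(iii) with the given constants (monotone in the constants — the printed *«obviously these
three conditions are satisfied in the original formulation»*), and the two deviation functionals of condition (iv),
`devU φ n = sup_{X̃^{−2}} |∂U_n(M˙(𝐔)) − 1|`, `devJ φ n = sup_{X̃^{−2}} |J_n(M˙(𝐔))|`; `condIV`, `space` = (iv) and
`U^c_j(X, α₀, α₁)`; `Shape117` = the output (1.17) of Proposition 9 [15] as a hypothesis on the model.  PROVED:
`eq117_scale` (the printed equality `B₃2α₀′L^{−2n}(L^nξ)² = 2B₃α₀′ξ²`), `condIV_of_shape117` and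
**`mem_space_of_shape117`** (the membership claim, with the explicit threshold `2B₃α₀′ ≤ α₀` for *«α₀′ sufficiently
small»*).  NOT typed: Proposition 9 [15] itself (row B11.Prop9), the further specialisation `𝐉 = D^{ξ*}_𝐔ξ^{−2}π Im ∂𝐔`
and the minimal configurations `U_j` (last two sentences of the paragraph).  No `Prop` placeholder beyond the
hypothesis shape, no new fact; axioms standard.  Unit `lit-balaban-p07` (Phase-2 seat p07; G.5-34(d)).
-/

namespace Literature.MathematicalPhysics.QuantumFieldTheory.Balaban1983to89.B12Eq117Membership

/-- **The printed equality in (1.17)**: `B₃·2α₀′·L^{−2n}(L^nξ)² = 2B₃α₀′ξ²`. [cite: Balaban1987RG1, (1.17) p.263] -/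
theorem eq117_scale (B₃ α₀' L ξ : ℝ) (hL : L ≠ 0) (n : ℕ) :
    B₃ * (2 * α₀') * (L ^ n)⁻¹ ^ 2 * (L ^ n * ξ) ^ 2 = 2 * B₃ * α₀' * ξ ^ 2 := by
  have hLn : L ^ n ≠ 0 := pow_ne_zero n hL
  field_simp

/-- The membership model at fixed `X`, `j`: configurations `Φ` (pairs `(𝐔, 𝐉)`), the set of those satisfying
(i)–(iii) with constants `α₀, α₁` (monotone in the constants), and the two deviation functionals of condition (iv)
indexed by the step `n`. [cite: Balaban1987RG1, (1.11)-(1.16) p.262] -/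
structure Model (Φ : Type*) where
  /-- the number of steps `j` (condition (iv) concerns `n ≤ j`). -/
  j : ℕ
  /-- `L` and `ξ = L^{−j}` -/
  L : ℝ
  ξ : ℝ
  /-- configurations satisfying (i)–(iii) on `X` with constants `α₀, α₁`. -/
  condI_III : ℝ → ℝ → Set Φ
  /-- *«obviously these three conditions are satisfied»* with larger constants. -/
  mono : ∀ ⦃α₀ α₀' α₁ α₁' : ℝ⦄, α₀' ≤ α₀ → α₁' ≤ α₁ → condI_III α₀' α₁' ⊆ condI_III α₀ α₁
  /-- `sup_{X̃^{−2}} |∂U_n(M˙(𝐔)) − 1|`. -/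
  devU : Φ → ℕ → ℝ
  /-- `sup_{X̃^{−2}} |J_n(M˙(𝐔))|`. -/
  devJ : Φ → ℕ → ℝ

namespace Model

variable {Φ : Type*} (M : Model Φ)

/-- **Condition (iv)** ((1.15)–(1.16), `γ₀ = α₀`): `|∂U_n(M˙(𝐔)) − 1| < α₀ξ²`, `|J_n(M˙(𝐔))| < α₀(L^nξ)²`, `n ≤ j`.
[cite: Balaban1987RG1, (1.15)-(1.16) p.262] -/
def condIV (α₀ : ℝ) : Set Φ :=
  {φ | ∀ n ≤ M.j, M.devU φ n < α₀ * M.ξ ^ 2 ∧ M.devJ φ n < α₀ * (M.L ^ n * M.ξ) ^ 2}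

/-- **`U^c_j(X, α₀, α₁)`** = (i)–(iii) with `α₀, α₁` and (iv) with `γ₀ = α₀`. [cite: Balaban1987RG1, (1.11)-(1.16) p.262] -/
def space (α₀ α₁ : ℝ) : Set Φ := M.condI_III α₀ α₁ ∩ M.condIV α₀

/-- **(1.17) as the output of Proposition 9 [15]** (hypothesis shape): every configuration satisfying (i)–(iii) with
`α₀′, α₁′` has `|∂U_n(M˙(𝐔)) − 1| < 2B₃α₀′ξ²` and `|J_n(M˙(𝐔))| < B₃2α₀′(L^nξ)²` on `X̃^{−2}`, `n ≤ j`.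
[cite: Balaban1987RG1, (1.17) p.263] -/
def Shape117 (B₃ α₀' α₁' : ℝ) : Prop :=
  ∀ φ ∈ M.condI_III α₀' α₁', ∀ n ≤ M.j,
    M.devU φ n < 2 * B₃ * α₀' * M.ξ ^ 2 ∧ M.devJ φ n < B₃ * (2 * α₀') * (M.L ^ n * M.ξ) ^ 2

/-- *«It is obvious that for α₀′ sufficiently small the above estimates imply the condition (iv)»* — explicitly: for
`2B₃α₀′ ≤ α₀`. [cite: Balaban1987RG1, (1.17) p.263] -/
theorem condIV_of_shape117 {B₃ α₀' α₁' α₀ : ℝ} (h117 : M.Shape117 B₃ α₀' α₁') (hsmall : 2 * B₃ * α₀' ≤ α₀)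
    {φ : Φ} (hφ : φ ∈ M.condI_III α₀' α₁') : φ ∈ M.condIV α₀ := by
  intro n hn
  obtain ⟨hU, hJ⟩ := h117 φ hφ n hn
  refine ⟨hU.trans_le ?_, hJ.trans_le ?_⟩
  · exact mul_le_mul_of_nonneg_right hsmall (sq_nonneg _)
  · nlinarith [sq_nonneg (M.L ^ n * M.ξ)]

/-- **The membership claim of p. 263**: *«thus the configuration (𝐔, 𝐉) belongs to the space U^c_j(X, α₀, α₁)»* —
for `α₀′ ≤ α₀`, `α₁′ ≤ α₁` and `2B₃α₀′ ≤ α₀`, every configuration satisfying (i)–(iii) with `α₀′, α₁′` lies in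
`U^c_j(X, α₀, α₁)`, given (1.17). [cite: Balaban1987RG1, (1.17) p.263] -/
theorem mem_space_of_shape117 {B₃ α₀' α₁' α₀ α₁ : ℝ} (h117 : M.Shape117 B₃ α₀' α₁') (h₀ : α₀' ≤ α₀)
    (h₁ : α₁' ≤ α₁) (hsmall : 2 * B₃ * α₀' ≤ α₀) {φ : Φ} (hφ : φ ∈ M.condI_III α₀' α₁') :
    φ ∈ M.space α₀ α₁ :=
  ⟨M.mono h₀ h₁ hφ, M.condIV_of_shape117 h117 hsmall hφ⟩

/-- The same, as an inclusion of sets: `{(i)–(iii) with α₀′, α₁′} ⊆ U^c_j(X, α₀, α₁)`.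
[cite: Balaban1987RG1, (1.17) p.263] -/
theorem condI_III_subset_space {B₃ α₀' α₁' α₀ α₁ : ℝ} (h117 : M.Shape117 B₃ α₀' α₁') (h₀ : α₀' ≤ α₀)
    (h₁ : α₁' ≤ α₁) (hsmall : 2 * B₃ * α₀' ≤ α₀) : M.condI_III α₀' α₁' ⊆ M.space α₀ α₁ :=
  fun _ hφ => M.mem_space_of_shape117 h117 h₀ h₁ hsmall hφ

/-- *«for α₀′ sufficiently small»*, quantified: with `B₃ > 0` the threshold is `α₀′ ≤ α₀/(2B₃)`.
[cite: Balaban1987RG1, (1.17) p.263] -/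
theorem threshold_iff {B₃ α₀' α₀ : ℝ} (hB₃ : 0 < B₃) : 2 * B₃ * α₀' ≤ α₀ ↔ α₀' ≤ α₀ / (2 * B₃) := by
  rw [le_div_iff₀ (by positivity)]
  constructor <;> intro h <;> linarith

end Model

end Literature.MathematicalPhysics.QuantumFieldTheory.Balaban1983to89.B12Eq117Membership
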